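import Summits.HodgeConjecture.CorCM.B01.Transposition.Item6CentralTypeAtPin
import Summits.HodgeConjecture.HodgeCM.Model.LiuIndexMuLiu
import Summits.HodgeConjecture.HodgeCM.Model.HypCensus.JLiuDeltaSign
import HarnessLib

/-!
# X3-Char item (E) at the COR-CM pin, INDEX LEVEL: Liu's table IS the package recipe `LiuIndex.muLiu`, and the continuous lines of
# `LiuIndex.I V ρ (muLiu ι₁ ρ)` are EXACTLY the weight-one `ι_μ` with `Φ_μ = Φ^δ(class)`

Cell pub-hodgecm2 (COR-CM), seat pin-3 (gen 10), 2026-08-23.  Port layers L69 (`LiuIndexCentralType`) and L72 (`LiuIndexMuLiu`).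

* `centralType_weightOneType_lineType_eq_muLiu` ∕ `muLiu_eq_of_sections` — for every section `ρ` and class `q`, under E's
  `hemb : (mk ι₁).embedding = ι₁` (and `muLiu ι₁ ρ = muLiu ι₁ ρ'` for any two sections, so the head's positioning `repAt a₀` and typing
  `GramClass.rep` sections may differ):
  `centralType (weightOneType Φ^δ(scalar ρ q)) = muLiu ι₁ ρ q` (`Transposition/Item6CentralTypeAtPin`
  `centralType_weightOneType_of_deltaPos_of_embedding_eq` + `SignRecipe.eta_eq_imagUnit` + `cmPlaceOver_eq_mk`);
* `exists_line_eq_ofCM_chiSplittingLine_toHeckeCharacter` — the POINTED CONSTRUCTOR at a character: for a section `ρ` of `mk` with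
  `ρ q = a` and `μ₀` conjugate symplectic OF WEIGHT ONE with `Φ_{μ₀} = Φ^δ(a)`, there is an index `j : I V ρ (muLiu ι₁ ρ)` over `q` whose line
  is `SplitLineE.ofCM V e₁ (vec a) … ι_{toHecke μ₀} …` ON THE NOSE ([Liu21, Prop. 4.13]'s weight-one summands are in the pinned index);
* `exists_weightOne_line_s_eq_chiSplittingLine_toHeckeCharacter` — conversely EVERY index `i : I V ρ (muLiu ι₁ ρ)` with continuous pair
  splitting has `(line i).s = ι_{toHecke μ}` for some `μ` conjugate symplectic OF WEIGHT ONE with `HasCMType μ (line i).lineType` — the REAL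
  fields `.μ ∕ .isConjugateSymplectic ∕ .hasWeight_one` of the per-line Liu datum `Thm418Rest` and the identification `T.PhiMu i ↔ ι₁ ∈ Φ_μ`
  (`SplitLine.PhiMuLine ι₁ (line i) := ι₁ ∈ (line i).lineType`), with no analytic hypothesis and no base character.

KERNEL only.  HC_CM is NOT proved here or anywhere; nothing here inhabits `hLiu ∕ hM`; no pointer moves.
-/

set_option autoImplicit false

noncomputable section

namespace Summit.HodgeConjecture.CorCM.Transposition.CentralTypeAtPin

open NumberField NumberField.InfinitePlace NumberField.mixedEmbedding IsDedekindDomain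
open scoped Matrix SchwartzMap Classical TensorProduct
open Literature.NumberTheory.Automorphic Literature.NumberTheory.Automorphic.UnitaryGroup Literature.NumberTheory.Weil1964
open Literature.NumberTheory.GelbartRogawski1991 Literature.NumberTheory.GelbartRogawski1991.UnitaryDualPair
open Literature.NumberTheory.GelbartRogawski1991.GRConstruction
open Literature.NumberTheory.Automorphic.Liu2021.Def411WeilCarriersDoubling
open Literature.NumberTheory.Automorphic.IdeleClassGroup
open Literature.NumberTheory.GaloisRepresentations
open Literature.RepresentationTheory.HarrisKudlaSweet1996
open HodgeCM HodgeCM.Model HodgeCM.Model.LiuIndex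
open HodgeCM.SignRecipe (lineType mem_lineType_iff eta_eq_imagUnit)
open HodgeCM.Model.ArchSideTerm (e₁)

variable {L : CMField} {ι₁ : (L : Type) →+* ℂ} (V : HermSpace3 L ι₁) (ρ ρ' : GramClass L → RealScalar L)

/-! ## §1 Liu's table is the package recipe -/

/-- **`centralType (weightOneType Φ^δ(scalar ρ q)) = muLiu ι₁ ρ q`** under E's identification `hemb : (mk ι₁).embedding = ι₁` (the package
table `muLiu` keys the sign at `w₁` on `ι₁ ∈ Φ^δ`, the central type keys it on `w₁.embedding ∈ Φ^δ`; `Φ^δ := SignRecipe.lineType` is cut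
out by `η_L = δ_L`, `SignRecipe.eta_eq_imagUnit`). [folklore] -/
theorem centralType_weightOneType_lineType_eq_muLiu (hemb : (InfinitePlace.mk ι₁).embedding = ι₁) (q : GramClass L) :
    centralType (L : Type) e₁ (frameD V) (frameD_real V) (RealScalar.vec (ρ q)) (RealScalar.vec_real (ρ q))
        (weightOneType (L : Type) (lineType (GramClass.scalar ρ q) (GramClass.conj_scalar ρ q) (GramClass.scalar_ne ρ q))) =
      muLiu ι₁ ρ q := by
  have hΦ : ∀ φ : (L : Type) →+* ℂ,
      φ ∈ (lineType (GramClass.scalar ρ q) (GramClass.conj_scalar ρ q) (GramClass.scalar_ne ρ q)).1 ↔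
        0 < (φ (imagUnit (L : Type) * (ρ q).1)).im := fun φ => by
    rw [mem_lineType_iff, eta_eq_imagUnit]; rfl
  have hw₁ : (cmPlaceOver (L : Type) (HypCensus.cmPlace (L : Type) ι₁)).1 = InfinitePlace.mk ι₁ :=
    cmPlaceOver_eq_mk (L : Type) _ ι₁ rfl
  rw [centralType_weightOneType_of_deltaPos_of_embedding_eq V (ρ q) _ hΦ hemb]
  unfold muLiu placeIndicator
  rw [hw₁]
  by_cases h : 0 < (ι₁ (imagUnit (L : Type) * (ρ q).1)).im
  · rw [if_pos h, if_pos ((hΦ ι₁).2 h)]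
  · rw [if_neg h, if_neg (mt (hΦ ι₁).1 h)]


/-- **the recipe `muLiu` does not depend on the representative section**: for two sections `ρ`, `ρ'` of `mk`, `muLiu ι₁ ρ = muLiu ι₁ ρ'`
(both read `Φ^δ` of ANY representative of the class, L72 `muLiu_mk`; the head of LANE (α) D positions the index by `repAt a₀` and types it
by `muLiu ι₁ GramClass.rep`). [folklore] -/
theorem muLiu_eq_of_sections (hρ : ∀ q, GramClass.mk (ρ q) = q) (hρ' : ∀ q, GramClass.mk (ρ' q) = q) : muLiu ι₁ ρ = muLiu ι₁ ρ' := by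
  funext q
  conv_lhs => rw [← hρ' q]
  rw [muLiu_mk hρ (ρ' q)]
  rfl

/-! ## §2 Liu's weight-one `ι_μ` are index lines (the pointed constructor at a character) -/

set_option maxHeartbeats 4000000 in
/-- **THE WEIGHT-ONE SUMMANDS ARE IN THE PINNED INDEX**: for a section `ρ` of `mk` with `ρ q = a` and `μ₀` conjugate symplectic OF WEIGHT
ONE with `Φ_{μ₀} = Φ^δ(a)`, the index `I V ρ (muLiu ι₁ ρ)` has an element over `q` whose line is the index line of record
`SplitLineE.ofCM V e₁ (vec a) … ι_{toHecke μ₀} …` ON THE NOSE (L69 `I.exists_line_eq_ofCM` with its `hm` DISCHARGED). [folklore] -/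
theorem exists_line_eq_ofCM_chiSplittingLine_toHeckeCharacter (hρ : ∀ q, GramClass.mk (ρ q) = q)
    (hρ' : ∀ q, GramClass.mk (ρ' q) = q) (hemb : (InfinitePlace.mk ι₁).embedding = ι₁) {q : GramClass L} {a : RealScalar L}
    (h : ρ q = a)
    (μ₀ : Literature.NumberTheory.Automorphic.IdeleClassGroup (L : Type) →ₜ* Circle) (hμ₀ : IsConjugateSymplectic (L : Type) μ₀)
    (hw : HasWeight (L : Type) μ₀ 1) (hΦμ : HasCMType (L : Type) μ₀ (lineType a.1 a.2.1 a.2.2)) :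
    ∃ j : I V ρ (muLiu ι₁ ρ'), j.1 = q ∧
      line V ρ (muLiu ι₁ ρ') j =
        SplitLineE.ofCM V e₁ (RealScalar.vec a) (RealScalar.vec_real a) (RealScalar.vec_ne a)
          (chiSplittingLine (L : Type) e₁ (frameD V) (frameD_real V) (frameD_ne V) (toHeckeCharacter (L : Type) μ₀)
            (isUnitary_toHeckeCharacter (L : Type) μ₀) (isSplittingChar_toHeckeCharacter_of_isConjugateSymplectic (L : Type) μ₀ hμ₀)
            (realDiagonal (L : Type) (RealScalar.vec a) (RealScalar.vec_real a))
            (isUnit_det_realDiagonal (L : Type) (RealScalar.vec a) (RealScalar.vec_real a) (RealScalar.vec_ne a))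
            (Matrix.diagonal (RealScalar.vec a)) (realDiagonal_map (L : Type) (RealScalar.vec a) (RealScalar.vec_real a)).symm)
          (isCompatible_chiSplittingLine (L : Type) e₁ (frameD V) (frameD_real V) (frameD_ne V) (toHeckeCharacter (L : Type) μ₀)
            (isUnitary_toHeckeCharacter (L : Type) μ₀) (isSplittingChar_toHeckeCharacter_of_isConjugateSymplectic (L : Type) μ₀ hμ₀)
            (realDiagonal (L : Type) (RealScalar.vec a) (RealScalar.vec_real a))
            (realDiagonal_isSymm (L : Type) (RealScalar.vec a) (RealScalar.vec_real a))
            (isUnit_det_realDiagonal (L : Type) (RealScalar.vec a) (RealScalar.vec_real a) (RealScalar.vec_ne a))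
            (Matrix.diagonal (RealScalar.vec a)) (realDiagonal_map (L : Type) (RealScalar.vec a) (RealScalar.vec_real a)).symm) := by
  subst h
  refine I.exists_line_eq_ofCM V (muLiu ι₁ ρ') rfl _ _ ?_
  rw [hρ q, ← muLiu_eq_of_sections ρ ρ' hρ hρ', ← centralType_weightOneType_lineType_eq_muLiu V ρ hemb q]
  exact hasCentralTypeAt_chiSplittingLine_toHeckeCharacter_weightOneType V (ρ q) μ₀ hμ₀ hw hΦμ

/-! ## §3 Every continuous index line is a weight-one `ι_μ` with `Φ_μ` the line's type -/

set_option maxHeartbeats 4000000 in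
/-- **EVERY CONTINUOUS INDEX LINE OF THE PIN IS `ι_μ`, `μ` CONJUGATE SYMPLECTIC OF WEIGHT ONE WITH `Φ_μ = (line i).lineType`**: for a
section `ρ` of `mk`, under `hemb`, an index `i : I V ρ (muLiu ι₁ ρ)` whose pair splitting is continuous has
`(line i).s = ι_{toHecke μ}` with `HasWeight μ 1` and `HasCMType μ (line i).lineType` — the REAL fields of the per-line Liu datum
([Liu21, Def. 4.1 ∕ 4.3, Prop. 4.13, App. D Step 2]) and the `PhiMu` identification, with NO analytic hypothesis and NO base character. [folklore] -/
theorem exists_weightOne_line_s_eq_chiSplittingLine_toHeckeCharacter (hρ : ∀ q, GramClass.mk (ρ q) = q)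
    (hρ' : ∀ q, GramClass.mk (ρ' q) = q) (hemb : (InfinitePlace.mk ι₁).embedding = ι₁) (i : I V ρ (muLiu ι₁ ρ'))
    (hsc : Continuous (i.2.1 : SplittingAt V (ρ i.1))) :
    ∃ (μ : Literature.NumberTheory.Automorphic.IdeleClassGroup (L : Type) →ₜ* Circle) (hμ : IsConjugateSymplectic (L : Type) μ),
      HasWeight (L : Type) μ 1 ∧ HasCMType (L : Type) μ (line V ρ (muLiu ι₁ ρ') i).lineType ∧
        (line V ρ (muLiu ι₁ ρ') i).s =
          chiSplittingLine (L : Type) e₁ (frameD V) (frameD_real V) (frameD_ne V) (toHeckeCharacter (L : Type) μ)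
            (isUnitary_toHeckeCharacter (L : Type) μ) (isSplittingChar_toHeckeCharacter_of_isConjugateSymplectic (L : Type) μ hμ)
            (realDiagonal (L : Type) (RealScalar.vec (ρ i.1)) (RealScalar.vec_real (ρ i.1)))
            (isUnit_det_realDiagonal (L : Type) (RealScalar.vec (ρ i.1)) (RealScalar.vec_real (ρ i.1)) (RealScalar.vec_ne (ρ i.1)))
            (Matrix.diagonal (RealScalar.vec (ρ i.1)))
            (realDiagonal_map (L : Type) (RealScalar.vec (ρ i.1)) (RealScalar.vec_real (ρ i.1))).symm := by
  have hlt : (line V ρ (muLiu ι₁ ρ') i).lineType =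
      lineType (GramClass.scalar ρ i.1) (GramClass.conj_scalar ρ i.1) (GramClass.scalar_ne ρ i.1) :=
    lineOf_lineType V ρ _ i
  have hP : HasCentralTypeAt V (ρ i.1) i.2.1
      (centralType (L : Type) e₁ (frameD V) (frameD_real V) (RealScalar.vec (ρ i.1)) (RealScalar.vec_real (ρ i.1))
        (weightOneType (L : Type) (lineType (GramClass.scalar ρ i.1) (GramClass.conj_scalar ρ i.1) (GramClass.scalar_ne ρ i.1)))) := by
    rw [centralType_weightOneType_lineType_eq_muLiu V ρ hemb i.1, muLiu_eq_of_sections ρ ρ' hρ hρ']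
    exact hasCentralTypeAt_of_mem' V hρ (muLiu ι₁ ρ') i
  rw [hlt]
  exact exists_weightOne_eq_chiSplittingLine_toHeckeCharacter_of_hasCentralTypeAt_weightOneType V (ρ i.1) _ i.2.1 hsc
    (isCompatAt_of_mem V ρ _ i) hP

end Summit.HodgeConjecture.CorCM.Transposition.CentralTypeAtPin

end
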